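import Summits.AnomalousDissipation.AnomalousDissipation.Theorems.NeutralTaylorWavesTaylorWaveQuasiSteadyHierarchyEnergy
import Summits.AnomalousDissipation.AnomalousDissipation.Theorems.NeutralTaylorWavesTaylorWaveQuasiSteadyHierarchyForce
import Literature.Analysis.FunctionSpaces.TorusAxisAverageCalculus

/-!
# The production identity of the ε-free hierarchy: dissipation = energy extracted from the mean strain
# (line `windfibred` rev 3; crux stmt-AnomalousDissipation-16293, `NeutralTaylorWaves.TaylorWaveQuasiSteady`)

On `T⁴ = T³ × T¹` (slow point `slow y`, fast phase `θ` = last coordinate) let `P_0` be the leading profile of a formal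
solution of the ε-free hierarchy (`divCoeff … 0 ≡ divCoeff … 1 ≡ 0`, `hierarchyCoeff … 0 ≡ hierarchyCoeff … 1 ≡ 0`,
`1 ≤ N`, `j i₀ ≠ 0`, `∂_{i₀}G ≡ 0`, smooth data), `A := axisAvg (Fin.last 3) P_0` its θ-MEAN (the mean flow) and
`V := P_0 − A` the fluctuation (the wave).  **Theorem (`production_identity`, registered `stub_hierarchyWProduction`):**
`∫_{T⁴} |k|²‖∂_θ P_0‖² = −∫_{T⁴} ⟪(V·∇_x)A, V⟫` — the leading (Taylor-scale) dissipation of the wave is the energy it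
extracts from the strain of the mean flow (profile-level Reynolds–Orr balance).  **Corollary
(`stub_hierarchyWShearNecessary`):** if `∂_{x_l}A ≡ 0` for all `l`, the leading dissipation vanishes — mean SHEAR is
necessary.  Proof: (1) `∫ |k|²‖∂_θP_0‖² = ∫ ⟪f∘slow, P_0⟫ = ∫ ⟪A, f∘slow⟫` (`Energy.leading_energy_identity`; a pairing
with a θ-invariant field only sees the θ-mean, `Torus.integral_inner_eq_integral_inner_axisAvg`); (2) `f∘slow` is the
θ-mean of `H := (P_0·∇_x)P_0 + (div_xP_0)P_0 − c_0∂_{x_2}P_0 + ∇_xQ_0` (`ForceIdentity.force_eq_fibre_mean`), so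
`∫ ⟪A, f∘slow⟫ = ∫ ⟪A, H⟫`; (3) slow integrations by parts (`Energy.integral_mul_inner_partialDeriv_eq`): transport pair
`= −∫ ⟪(P_0·∇_x)A, P_0⟫`, drift `∫ ⟪∂_{x_2}P_0, A⟫ = ∫ ⟪∂_{x_2}A, A⟫ = 0`, pressure `= −∫ Q_0 div_xA = 0` since
`div_xA = axisAvg (div_xP_0) = −∂_θ axisAvg (P_1·k) = 0` (`d_1 = 0`, `Torus.partialDeriv_axisAvg`, θ-means have no
θ-derivative); (4) split `P_0 = A + V`: the cross terms carry the θ-invariant factors `(A·∇_x)A`, `⟪∂_{x_l}A, A⟫` and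
reduce by the pairing lemma to `∫ ⟪(A·∇_x)A, A⟫ = −½∫ (div_xA)|A|² = 0`.  Folklore (energy method for the profile
equations of large-amplitude monophase oscillations, Cheverry–Guès–Métivier, Ann. Sci. ENS 36 (2003) §2).
-/
-- `Summit.<Summit>.<Problem>` is the tree's mandated summit-side namespace (CONVENTIONS §2); for this
-- single-conjunct summit the two coincide, so the duplicate is deliberate.
set_option linter.dupNamespace false

noncomputable section

open scoped BigOperators InnerProductSpace ContDiff
open MeasureTheory
open Literature.Analysis.FunctionSpaces Literature.Analysis.FunctionSpaces.Torus

namespace Summit.AnomalousDissipation.AnomalousDissipation.Theorems.TaylorWaveQuasiSteady.Production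

open Summit.AnomalousDissipation.AnomalousDissipation.Theorems.TaylorWaveQuasiSteady

section General

variable {d : Type*} [DecidableEq d] {F : Type*} [NormedAddCommGroup F] [NormedSpace ℝ F]

/-- A field invariant under the translations along the `i`-th axis has no `i`-th derivative (the line function in
the definition of `Torus.partialDeriv` is constant). [folklore] -/
theorem partialDeriv_eq_zero_of_forall_add_single {Φ : UnitAddTorus d → F} (i : d)
    (hΦ : ∀ (s : UnitAddCircle) (x : UnitAddTorus d), Φ (x + Pi.single i s) = Φ x) (x : UnitAddTorus d) :
    partialDeriv i Φ x = 0 := by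
  have h : (fun t : ℝ => Φ (x + Torus.proj (t • EuclideanSpace.single i (1 : ℝ)))) = fun _ => Φ x := by
    funext t
    rw [proj_smul_single, hΦ]
  simp only [Torus.partialDeriv, Torus.lineDeriv]
  rw [h, deriv_const]

/-- Partial derivatives of a field invariant under the translations along the `i`-th axis are invariant (pure
rewriting of the line functions). [folklore] -/
theorem partialDeriv_add_single_of_forall_add_single' {Φ : UnitAddTorus d → F} {i : d}
    (hΦ : ∀ (s : UnitAddCircle) (x : UnitAddTorus d), Φ (x + Pi.single i s) = Φ x) (m : d)
    (s : UnitAddCircle) (x : UnitAddTorus d) :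
    partialDeriv m Φ (x + Pi.single i s) = partialDeriv m Φ x := by
  simp only [Torus.partialDeriv, Torus.lineDeriv]
  congr 1
  funext t
  rw [add_right_comm, hΦ]

/-- Coordinates commute with the axis average, for continuous fields `T^d → ℝ^ι`. [folklore] -/
theorem axisAvg_apply_coord' {ι : Type*} [Fintype ι] {v : UnitAddTorus d → EuclideanSpace ℝ ι}
    (hv : Continuous v) (i : d) (l : ι) (x : UnitAddTorus d) :
    axisAvg i v x l = axisAvg i (fun y => v y l) x := by
  rw [axisAvg_apply, axisAvg_apply]
  have hint : Integrable (fun s : UnitAddCircle => v (x + Pi.single i s)) volume :=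
    (hv.comp (continuous_const.add (continuous_single i))).integrable_of_hasCompactSupport
      (HasCompactSupport.of_compactSpace _)
  exact ((EuclideanSpace.proj l : EuclideanSpace ℝ ι →L[ℝ] ℝ).integral_comp_comm hint).symm

end General

variable {F : Type*} [NormedAddCommGroup F] [NormedSpace ℝ F]

/-- θ-means have no θ-derivative: `∂_θ (axisAvg θ Φ) = 0` on `T⁴`. [folklore] -/
theorem partialDeriv_last_axisAvg (Φ : UnitAddTorus (Fin 4) → F) (y : UnitAddTorus (Fin 4)) :
    partialDeriv (Fin.last 3) (axisAvg (Fin.last 3) Φ) y = 0 :=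
  partialDeriv_eq_zero_of_forall_add_single (Fin.last 3) (fun s x => axisAvg_add_single (Fin.last 3) Φ s x) y

/-- Slow derivatives commute with the θ-mean (smooth profiles). [folklore] -/
theorem sDeriv_axisAvg [CompleteSpace F] {Φ : UnitAddTorus (Fin 4) → F} (hΦ : IsSmooth Φ) (l : Fin 3) :
    sDeriv l (axisAvg (Fin.last 3) Φ) = axisAvg (Fin.last 3) (sDeriv l Φ) :=
  partialDeriv_axisAvg hΦ (Fin.last 3) l.castSucc

/-- **The θ-mean as a fibre integral**: `axisAvg θ H y = ∫_{T¹} H (slow y, s) ds` (translation invariance of the Haar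
integral on `T¹`; no integrability needed). [folklore] -/
theorem axisAvg_last_eq_integral_snoc (H : UnitAddTorus (Fin 4) → F) (y : UnitAddTorus (Fin 4)) :
    axisAvg (Fin.last 3) H y = ∫ s : UnitAddCircle, H (@Fin.snoc 3 (fun _ => UnitAddCircle) (slow y) s) := by
  rw [axisAvg_apply]
  have h : ∀ s : UnitAddCircle, y + Pi.single (Fin.last 3) s =
      (@Fin.snoc 3 (fun _ => UnitAddCircle) (slow y) (y (Fin.last 3) + s) : UnitAddTorus (Fin 4)) := by
    intro s
    funext m
    refine Fin.lastCases ?_ (fun l => ?_) m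
    · simp only [Pi.add_apply, Fin.snoc_last, Pi.single_eq_same]
    · simp only [Pi.add_apply, Fin.snoc_castSucc, Pi.single_eq_of_ne (Fin.castSucc_lt_last l).ne, add_zero, slow]
  simp_rw [h]
  exact integral_add_left_eq_self (μ := (volume : Measure UnitAddCircle))
    (fun s => H (@Fin.snoc 3 (fun _ => UnitAddCircle) (slow y) s)) (y (Fin.last 3))

/-- **The pairing lemma on `T⁴`, smooth form**: for a θ-invariant smooth `A` and a smooth `B`,
`∫ ⟪A, B⟫ = ∫ ⟪A, axisAvg θ B⟫` (`Torus.integral_inner_eq_integral_inner_axisAvg`). [folklore] -/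
theorem integral_inner_eq_integral_inner_axisAvg_last {E : Type*} [NormedAddCommGroup E] [InnerProductSpace ℝ E]
    [CompleteSpace E] {A B : UnitAddTorus (Fin 4) → E}
    (hAi : ∀ (s : UnitAddCircle) (x : UnitAddTorus (Fin 4)), A (x + Pi.single (Fin.last 3) s) = A x)
    (hA : IsSmooth A) (hB : IsSmooth B) :
    ∫ x, ⟪A x, B x⟫_ℝ = ∫ x, ⟪A x, axisAvg (Fin.last 3) B x⟫_ℝ :=
  integral_inner_eq_integral_inner_axisAvg (Fin.last 3) hAi hA.continuous.aestronglyMeasurable hB.integrable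
    (integrable_inner_shift_of_memLp (Fin.last 3) (hA.memLp 2) (hB.memLp 2))

/-- **Slow transport, by parts**: `∫ ⟪(Φ·∇_x)U, V⟫ = −∫ ⟪(Φ·∇_x)V, U⟫ − ∫ (div_x Φ) ⟪U, V⟫` for smooth profiles
(`Energy.integral_mul_inner_partialDeriv_eq`, coordinate by coordinate). [folklore] -/
theorem integral_inner_sum_smul_sDeriv {Φ U V : UnitAddTorus (Fin 4) → EuclideanSpace ℝ (Fin 3)}
    (hΦ : IsSmooth Φ) (hU : IsSmooth U) (hV : IsSmooth V) :
    ∫ y, ⟪∑ l : Fin 3, (Φ y) l • sDeriv l U y, V y⟫_ℝ =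
      -(∫ y, ⟪∑ l : Fin 3, (Φ y) l • sDeriv l V y, U y⟫_ℝ)
        - ∫ y, (∑ l : Fin 3, (sDeriv l Φ y) l) * ⟪U y, V y⟫_ℝ := by
  have hΦ1 : IsContDiff 1 Φ := hΦ.isContDiff (by simp)
  have hl : ∀ l : Fin 3, ∫ y, (Φ y) l * ⟪sDeriv l U y, V y⟫_ℝ =
      -(∫ y, (Φ y) l * ⟪sDeriv l V y, U y⟫_ℝ) - ∫ y, (sDeriv l Φ y) l * ⟪U y, V y⟫_ℝ := by
    intro l
    have h := Energy.integral_mul_inner_partialDeriv_eq (Energy.isSmooth_coord hΦ l) hU hV l.castSucc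
    have hsym : (fun y => (Φ y) l * ⟪U y, partialDeriv l.castSucc V y⟫_ℝ) =
        fun y => (Φ y) l * ⟪partialDeriv l.castSucc V y, U y⟫_ℝ :=
      funext fun y => by rw [real_inner_comm]
    have hcoord : (fun y => partialDeriv l.castSucc (fun y => (Φ y) l) y * ⟪U y, V y⟫_ℝ) =
        fun y => (sDeriv l Φ y) l * ⟪U y, V y⟫_ℝ :=
      funext fun y => by rw [Energy.partialDeriv_apply_coord' hΦ1]; rfl
    rw [hsym, hcoord] at h
    simp only [sDeriv] at h ⊢
    exact h
  simp_rw [Energy.inner_sum_smul_left]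
  rw [integral_finsetSum _ fun l _ =>
      (Energy.isSmooth_mul (Energy.isSmooth_coord hΦ l) ((FormalExpansion.isSmooth_sDeriv hU l).inner hV)).integrable,
    integral_finsetSum _ fun l _ =>
      (Energy.isSmooth_mul (Energy.isSmooth_coord hΦ l) ((FormalExpansion.isSmooth_sDeriv hV l).inner hU)).integrable]
  have hdiv : ∫ y, (∑ l : Fin 3, (sDeriv l Φ y) l) * ⟪U y, V y⟫_ℝ =
      ∑ l : Fin 3, ∫ y, (sDeriv l Φ y) l * ⟪U y, V y⟫_ℝ := by
    simp_rw [Finset.sum_mul]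
    exact integral_finsetSum _ fun l _ =>
      (Energy.isSmooth_mul (Energy.isSmooth_coord (FormalExpansion.isSmooth_sDeriv hΦ l) l) (hU.inner hV)).integrable
  rw [hdiv, Finset.sum_congr rfl fun l _ => hl l, Finset.sum_sub_distrib, ← Finset.sum_neg_distrib]

section MeanFlow

variable {A P₀ : UnitAddTorus (Fin 4) → EuclideanSpace ℝ (Fin 3)}

/-- **The slow drift pairs to zero with the θ-mean**: `∫ ⟪∂_{x_l} P_0, A⟫ = ∫ ⟪∂_{x_l} A, A⟫ = 0` for the θ-mean
`A` of `P_0`. [folklore] -/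
theorem integral_inner_sDeriv_axisAvg_eq_zero (hP₀ : IsSmooth P₀) (hA : IsSmooth A)
    (hAi : ∀ (s : UnitAddCircle) (x : UnitAddTorus (Fin 4)), A (x + Pi.single (Fin.last 3) s) = A x)
    (hPA : axisAvg (Fin.last 3) P₀ = A) (l : Fin 3) :
    ∫ y, ⟪sDeriv l P₀ y, A y⟫_ℝ = 0 := by
  have h1 : ∫ y, ⟪sDeriv l P₀ y, A y⟫_ℝ = ∫ y, ⟪A y, sDeriv l P₀ y⟫_ℝ :=
    integral_congr_ae (ae_of_all _ fun y => real_inner_comm _ _)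
  rw [h1, integral_inner_eq_integral_inner_axisAvg_last hAi hA (FormalExpansion.isSmooth_sDeriv hP₀ l),
    ← sDeriv_axisAvg hP₀ l, hPA]
  have h2 : ∫ y, ⟪A y, sDeriv l A y⟫_ℝ = ∫ y, ⟪sDeriv l A y, A y⟫_ℝ :=
    integral_congr_ae (ae_of_all _ fun y => real_inner_comm _ _)
  rw [h2]
  exact Energy.integral_inner_sDeriv_self_eq_zero (P := fun _ => A) (fun _ => hA) l

/-- **The slow pressure pairs to zero with a slow-divergence-free field**: `∫ ∑ᵢ (∂_{xᵢ}Q_0) Aᵢ = −∫ Q_0 div_x A = 0`.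
[folklore] -/
theorem integral_sum_sDeriv_mul_apply_eq_zero {Q₀ : UnitAddTorus (Fin 4) → ℝ} (hQ₀ : IsSmooth Q₀) (hA : IsSmooth A)
    (hdivA : ∀ y, ∑ i : Fin 3, (sDeriv i A y) i = 0) :
    ∫ y, ∑ i : Fin 3, sDeriv i Q₀ y * (A y) i = 0 := by
  have hA1 : IsContDiff 1 A := hA.isContDiff (by simp)
  rw [integral_finsetSum _ fun i _ =>
    (Energy.isSmooth_mul (FormalExpansion.isSmooth_sDeriv hQ₀ i) (Energy.isSmooth_coord hA i)).integrable]
  have hi : ∀ i : Fin 3, ∫ y, sDeriv i Q₀ y * (A y) i = -∫ y, Q₀ y * (sDeriv i A y) i := by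
    intro i
    simp only [sDeriv]
    rw [Energy.integral_partialDeriv_mul_eq_neg hQ₀ (Energy.isSmooth_coord hA i) i.castSucc]
    congr 1
    refine integral_congr_ae (ae_of_all _ fun y => ?_)
    dsimp only
    rw [Energy.partialDeriv_apply_coord' hA1]
  simp_rw [hi]
  rw [Finset.sum_neg_distrib, ← integral_finsetSum _ fun i _ =>
    (Energy.isSmooth_mul hQ₀ (Energy.isSmooth_coord (FormalExpansion.isSmooth_sDeriv hA i) i)).integrable]
  simp_rw [← Finset.mul_sum, hdivA, mul_zero, integral_zero, neg_zero]

/-- **Splitting `P_0 = A + V` in `∫ ⟪(P_0·∇_x)A, P_0⟫`**: for the θ-mean `A` of `P_0` with `div_x A = 0`,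
`∫ ⟪(V·∇_x)A, V⟫ = ∫ ⟪(P_0·∇_x)A, P_0⟫` (`V = P_0 − A`): the three cross terms contain the θ-invariant factors
`(A·∇_x)A`, `⟪∂_{x_l}A, A⟫` and reduce by the pairing lemma to `∫ ⟪(A·∇_x)A, A⟫ = −½ ∫ (div_x A)|A|² = 0`. [folklore] -/
theorem integral_production_split (hP₀ : IsSmooth P₀) (hA : IsSmooth A)
    (hAi : ∀ (s : UnitAddCircle) (x : UnitAddTorus (Fin 4)), A (x + Pi.single (Fin.last 3) s) = A x)
    (hPA : axisAvg (Fin.last 3) P₀ = A) (hdivA : ∀ y, ∑ i : Fin 3, (sDeriv i A y) i = 0) :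
    ∫ y, ⟪∑ l : Fin 3, ((P₀ y - A y) l) • sDeriv l A y, P₀ y - A y⟫_ℝ =
      ∫ y, ⟪∑ l : Fin 3, (P₀ y) l • sDeriv l A y, P₀ y⟫_ℝ := by
  have hsDA : ∀ l, IsSmooth (sDeriv l A) := fun l => FormalExpansion.isSmooth_sDeriv hA l
  have hsDAi : ∀ (l : Fin 3) (s : UnitAddCircle) (x : UnitAddTorus (Fin 4)),
      sDeriv l A (x + Pi.single (Fin.last 3) s) = sDeriv l A x :=
    fun l s x => partialDeriv_add_single_of_forall_add_single' hAi l.castSucc s x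
  set W : UnitAddTorus (Fin 4) → EuclideanSpace ℝ (Fin 3) :=
    fun y => WithLp.toLp 2 (fun l : Fin 3 => ⟪sDeriv l A y, A y⟫_ℝ) with hWdef
  have hW : IsSmooth W := ForceIdentity.isSmooth_toLp_fin fun l => (hsDA l).inner hA
  have hWi : ∀ (s : UnitAddCircle) (x : UnitAddTorus (Fin 4)), W (x + Pi.single (Fin.last 3) s) = W x := by
    intro s x
    simp only [hWdef, hsDAi, hAi]
  have hpW : ∀ (Φ : UnitAddTorus (Fin 4) → EuclideanSpace ℝ (Fin 3)) (y : UnitAddTorus (Fin 4)),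
      ⟪∑ l : Fin 3, (Φ y) l • sDeriv l A y, A y⟫_ℝ = ⟪W y, Φ y⟫_ℝ := by
    intro Φ y
    rw [Energy.inner_sum_smul_left, Energy.inner_eq_sum_mul]
    refine Finset.sum_congr rfl fun l _ => ?_
    simp only [hWdef, PiLp.toLp_apply]
    ring
  have hT : IsSmooth (fun y => ∑ l : Fin 3, (A y) l • sDeriv l A y) := ForceIdentity.isSmooth_sum_apply_smul hA hsDA
  have hTi : ∀ (s : UnitAddCircle) (x : UnitAddTorus (Fin 4)),
      (∑ l : Fin 3, (A (x + Pi.single (Fin.last 3) s)) l • sDeriv l A (x + Pi.single (Fin.last 3) s)) =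
        ∑ l : Fin 3, (A x) l • sDeriv l A x := by
    intro s x
    simp only [hsDAi, hAi]
  -- (a) `∫ ⟪(A·∇)A, A⟫ = 0`
  have Ea : ∫ y, ⟪∑ l : Fin 3, (A y) l • sDeriv l A y, A y⟫_ℝ = 0 := by
    have h := integral_inner_sum_smul_sDeriv hA hA hA
    simp_rw [hdivA, zero_mul, integral_zero, sub_zero] at h
    linarith
  -- (b) `∫ ⟪(P_0·∇)A, A⟫ = ∫ ⟪W, P_0⟫ = ∫ ⟪W, A⟫ = 0`
  have Eb : ∫ y, ⟪∑ l : Fin 3, (P₀ y) l • sDeriv l A y, A y⟫_ℝ = 0 := by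
    simp_rw [hpW]
    rw [integral_inner_eq_integral_inner_axisAvg_last hWi hW hP₀, hPA]
    have h := Ea
    simp_rw [hpW] at h
    exact h
  -- (c) `∫ ⟪(A·∇)A, P_0⟫ = ∫ ⟪(A·∇)A, A⟫ = 0`
  have Ec : ∫ y, ⟪∑ l : Fin 3, (A y) l • sDeriv l A y, P₀ y⟫_ℝ = 0 := by
    rw [integral_inner_eq_integral_inner_axisAvg_last hTi hT hP₀, hPA]
    exact Ea
  have hpt : ∀ y, ⟪∑ l : Fin 3, ((P₀ y - A y) l) • sDeriv l A y, P₀ y - A y⟫_ℝ =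
      ⟪∑ l : Fin 3, (P₀ y) l • sDeriv l A y, P₀ y⟫_ℝ - ⟪∑ l : Fin 3, (P₀ y) l • sDeriv l A y, A y⟫_ℝ
        - (⟪∑ l : Fin 3, (A y) l • sDeriv l A y, P₀ y⟫_ℝ - ⟪∑ l : Fin 3, (A y) l • sDeriv l A y, A y⟫_ℝ) := by
    intro y
    have hs : ∑ l : Fin 3, ((P₀ y - A y) l) • sDeriv l A y =
        (∑ l : Fin 3, (P₀ y) l • sDeriv l A y) - ∑ l : Fin 3, (A y) l • sDeriv l A y := by
      rw [← Finset.sum_sub_distrib]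
      exact Finset.sum_congr rfl fun l _ => by rw [PiLp.sub_apply, sub_smul]
    rw [hs, inner_sub_left, inner_sub_right, inner_sub_right]
  have i1 : Integrable (fun y => ⟪∑ l : Fin 3, (P₀ y) l • sDeriv l A y, P₀ y⟫_ℝ) :=
    ((ForceIdentity.isSmooth_sum_apply_smul hP₀ hsDA).inner hP₀).integrable
  have i2 : Integrable (fun y => ⟪∑ l : Fin 3, (P₀ y) l • sDeriv l A y, A y⟫_ℝ) :=
    ((ForceIdentity.isSmooth_sum_apply_smul hP₀ hsDA).inner hA).integrable
  have i3 : Integrable (fun y => ⟪∑ l : Fin 3, (A y) l • sDeriv l A y, P₀ y⟫_ℝ) := (hT.inner hP₀).integrable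
  have i4 : Integrable (fun y => ⟪∑ l : Fin 3, (A y) l • sDeriv l A y, A y⟫_ℝ) := (hT.inner hA).integrable
  have i12 : Integrable (fun y => ⟪∑ l : Fin 3, (P₀ y) l • sDeriv l A y, P₀ y⟫_ℝ
      - ⟪∑ l : Fin 3, (P₀ y) l • sDeriv l A y, A y⟫_ℝ) := i1.sub i2
  have i34 : Integrable (fun y => ⟪∑ l : Fin 3, (A y) l • sDeriv l A y, P₀ y⟫_ℝ
      - ⟪∑ l : Fin 3, (A y) l • sDeriv l A y, A y⟫_ℝ) := i3.sub i4
  rw [integral_congr_ae (ae_of_all _ hpt), integral_sub i12 i34, integral_sub i1 i2, integral_sub i3 i4, Eb, Ec, Ea]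
  ring

end MeanFlow

section Body

variable {j : Fin 3 → ℤ} {G : UnitAddTorus (Fin 3) → ℝ} {f : UnitAddTorus (Fin 3) → EuclideanSpace ℝ (Fin 3)} {N : ℕ}
  {P : ℕ → UnitAddTorus (Fin 4) → EuclideanSpace ℝ (Fin 3)} {Q : ℕ → UnitAddTorus (Fin 4) → ℝ} {c : ℕ → ℝ}

/-- **The mean flow is slow-divergence-free**: with `d_1 = div_x P_0 + ∂_θ(P_1·k) = 0`,
`div_x (axisAvg θ P_0) = axisAvg θ (div_x P_0) = −∂_θ axisAvg θ (P_1·k) = 0`. [folklore] -/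
theorem sum_sDeriv_axisAvg_apply_eq_zero (hG : IsSmooth G) (hP : ∀ a, IsSmooth (P a))
    (hd1 : ∀ y, (∑ i : Fin 3, (sDeriv i (P 0) y) i) + ∑ i : Fin 3, (fDeriv j G i (P 1) y) i = 0)
    (y : UnitAddTorus (Fin 4)) :
    ∑ i : Fin 3, (sDeriv i (axisAvg (Fin.last 3) (P 0)) y) i = 0 := by
  have hP0 := hP 0
  have hP1 := hP 1
  have h1 : ∀ i : Fin 3, (sDeriv i (axisAvg (Fin.last 3) (P 0)) y) i =
      axisAvg (Fin.last 3) (fun z => (sDeriv i (P 0) z) i) y := by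
    intro i
    rw [sDeriv_axisAvg hP0 i, axisAvg_apply_coord' (FormalExpansion.isSmooth_sDeriv hP0 i).continuous]
  have h2 : ∑ i : Fin 3, axisAvg (Fin.last 3) (fun z => (sDeriv i (P 0) z) i) y =
      axisAvg (Fin.last 3) (fun z => ∑ i : Fin 3, (sDeriv i (P 0) z) i) y := by
    simp only [axisAvg_apply]
    rw [integral_finsetSum _ fun i _ => ?_]
    exact (((Energy.isSmooth_coord (FormalExpansion.isSmooth_sDeriv hP0 i) i).continuous.comp
      (continuous_const.add (continuous_single (Fin.last 3)))).integrable_of_hasCompactSupport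
      (HasCompactSupport.of_compactSpace _))
  set π : UnitAddTorus (Fin 4) → ℝ := fun y => ∑ l : Fin 3, (P 1 y) l * phaseGrad j G l (slow y) with hπ
  have hπs : IsSmooth π :=
    Energy.isSmooth_fsum Finset.univ fun l _ =>
      Energy.isSmooth_mul (Energy.isSmooth_coord hP1 l) (Energy.isSmooth_phaseGrad_slow j hG l)
  have h3 : (fun z => ∑ i : Fin 3, (sDeriv i (P 0) z) i) = fun z => -partialDeriv (Fin.last 3) π z := by
    funext z
    rw [hπ, Energy.partialDeriv_last_sum_coord_mul_phaseGrad hG hP1 z]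
    exact eq_neg_of_add_eq_zero_left (hd1 z)
  have h4 : axisAvg (Fin.last 3) (fun z => -partialDeriv (Fin.last 3) π z) y =
      -axisAvg (Fin.last 3) (partialDeriv (Fin.last 3) π) y := integral_neg _
  rw [Finset.sum_congr rfl fun i _ => h1 i, h2, h3, h4, ← partialDeriv_axisAvg hπs, partialDeriv_last_axisAvg,
    neg_zero]

/-- **Production identity of the ε-free hierarchy.**  For a formal solution of order `N ≥ 1` (orders `0` and `1` of
`divCoeff` and `hierarchyCoeff` vanish) with `j i₀ ≠ 0`, `∂_{i₀}G ≡ 0`, and with `A := axisAvg θ P_0` the θ-mean of the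
leading profile and `V := P_0 − A` its fluctuation:
`∫_{T⁴} |k|²‖∂_θP_0‖² = −∫_{T⁴} ⟪(V·∇_x)A, V⟫` — the dissipation of the wave is the energy it extracts from the
mean strain. [folklore] -/
theorem production_identity {i₀ : Fin 3} (hj : j i₀ ≠ 0) (hG0 : ∀ x, partialDeriv i₀ G x = 0)
    (hG : IsSmooth G) (hf : IsSmooth f) (hP : ∀ a, IsSmooth (P a)) (hQ : ∀ a, IsSmooth (Q a)) (hN : 1 ≤ N)
    (hd0 : ∀ y, divCoeff j G N P 0 y = 0) (hd1 : ∀ y, divCoeff j G N P 1 y = 0)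
    (hM0 : ∀ y, hierarchyCoeff j G f N P Q c 0 y = 0) (hM1 : ∀ y, hierarchyCoeff j G f N P Q c 1 y = 0) :
    ∫ y, dissDensity j G (P 0) y =
      -∫ y, ⟪∑ l : Fin 3, ((P 0 y - axisAvg (Fin.last 3) (P 0) y) l) • sDeriv l (axisAvg (Fin.last 3) (P 0)) y,
        P 0 y - axisAvg (Fin.last 3) (P 0) y⟫_ℝ := by
  have hP0 := hP 0
  have hA : IsSmooth (axisAvg (Fin.last 3) (P 0)) := hP0.axisAvg (Fin.last 3)
  have hAi : ∀ (s : UnitAddCircle) (x : UnitAddTorus (Fin 4)),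
      axisAvg (Fin.last 3) (P 0) (x + Pi.single (Fin.last 3) s) = axisAvg (Fin.last 3) (P 0) x :=
    fun s x => axisAvg_add_single (Fin.last 3) (P 0) s x
  have hd1' : ∀ y, (∑ i : Fin 3, (sDeriv i (P 0) y) i) + ∑ i : Fin 3, (fDeriv j G i (P 1) y) i = 0 := fun y => by
    rw [← Unfold.divCoeff_succ j G N P 0 hN y]
    exact hd1 y
  have hdivA : ∀ y, ∑ i : Fin 3, (sDeriv i (axisAvg (Fin.last 3) (P 0)) y) i = 0 :=
    sum_sDeriv_axisAvg_apply_eq_zero hG hP hd1'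
  have hsD : ∀ l, IsSmooth (sDeriv l (P 0)) := fun l => FormalExpansion.isSmooth_sDeriv hP0 l
  have hsDQ : ∀ l, IsSmooth (sDeriv l (Q 0)) := fun l => FormalExpansion.isSmooth_sDeriv (hQ 0) l
  -- (1) the leading energy identity, and the force pairs only with the θ-mean
  have hfs : IsSmooth (fun y : UnitAddTorus (Fin 4) => f (slow y)) := ResidualTransfer.isSmooth_comp_slow hf
  have hfi : ∀ (s : UnitAddCircle) (x : UnitAddTorus (Fin 4)), f (slow (x + Pi.single (Fin.last 3) s)) = f (slow x) :=
    fun s x => by rw [Energy.slow_add_single_last]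
  have h1 : ∫ y, dissDensity j G (P 0) y = ∫ y, ⟪axisAvg (Fin.last 3) (P 0) y, f (slow y)⟫_ℝ := by
    rw [Energy.leading_energy_identity hj hG0 hG hP hQ hN hd0 hd1 hM0 hM1,
      integral_inner_eq_integral_inner_axisAvg_last hfi hfs hP0]
    exact integral_congr_ae (ae_of_all _ fun y => real_inner_comm _ _)
  -- (2) the force is the θ-mean of `H`; pair `H` itself with `A`
  set H : UnitAddTorus (Fin 4) → EuclideanSpace ℝ (Fin 3) := fun z => (∑ l : Fin 3, (P 0 z) l • sDeriv l (P 0) z)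
      + (∑ i : Fin 3, (sDeriv i (P 0) z) i) • P 0 z - c 0 • sDeriv 2 (P 0) z
      + WithLp.toLp 2 (fun i : Fin 3 => sDeriv i (Q 0) z) with hHdef
  have hHs : IsSmooth H :=
    (((ForceIdentity.isSmooth_sum_apply_smul hP0 hsD).add
      ((Energy.isSmooth_fsum Finset.univ fun i _ => Energy.isSmooth_coord (hsD i) i).smul' hP0)).sub
      ((hsD 2).smul (c 0))).add (ForceIdentity.isSmooth_toLp_fin fun i => hsDQ i)
  have h2 : ∫ y, ⟪axisAvg (Fin.last 3) (P 0) y, f (slow y)⟫_ℝ = ∫ y, ⟪H y, axisAvg (Fin.last 3) (P 0) y⟫_ℝ := by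
    have hH : ∀ y, f (slow y) = axisAvg (Fin.last 3) H y := fun y => by
      rw [axisAvg_last_eq_integral_snoc]
      exact ForceIdentity.force_eq_fibre_mean hG hP hQ hN hd0 hd1 hM1 (slow y)
    simp_rw [hH]
    rw [← integral_inner_eq_integral_inner_axisAvg_last hAi hA hHs]
    exact integral_congr_ae (ae_of_all _ fun y => real_inner_comm _ _)
  -- (3) the four pieces of `⟪H, A⟫`
  set p1 : UnitAddTorus (Fin 4) → ℝ := fun y =>
    ⟪∑ l : Fin 3, (P 0 y) l • sDeriv l (P 0) y, axisAvg (Fin.last 3) (P 0) y⟫_ℝ with hp1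
  set p2 : UnitAddTorus (Fin 4) → ℝ := fun y =>
    (∑ i : Fin 3, (sDeriv i (P 0) y) i) * ⟪P 0 y, axisAvg (Fin.last 3) (P 0) y⟫_ℝ with hp2
  set p3 : UnitAddTorus (Fin 4) → ℝ := fun y => c 0 * ⟪sDeriv 2 (P 0) y, axisAvg (Fin.last 3) (P 0) y⟫_ℝ with hp3
  set p4 : UnitAddTorus (Fin 4) → ℝ := fun y => ∑ i : Fin 3, sDeriv i (Q 0) y * (axisAvg (Fin.last 3) (P 0) y) i
    with hp4
  have key : ∀ y, ⟪H y, axisAvg (Fin.last 3) (P 0) y⟫_ℝ = p1 y + p2 y - p3 y + p4 y := by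
    intro y
    simp only [hHdef, hp1, hp2, hp3, hp4, inner_add_left, inner_sub_left, real_inner_smul_left]
    congr 1
    rw [Energy.inner_eq_sum_mul]
  have i1 : Integrable p1 := ((ForceIdentity.isSmooth_sum_apply_smul hP0 hsD).inner hA).integrable
  have i2 : Integrable p2 :=
    (Energy.isSmooth_mul (Energy.isSmooth_fsum Finset.univ fun i _ => Energy.isSmooth_coord (hsD i) i)
      (hP0.inner hA)).integrable
  have i3 : Integrable p3 := (Energy.isSmooth_mul (isSmooth_const (c 0)) ((hsD 2).inner hA)).integrable
  have i4 : Integrable p4 :=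
    (Energy.isSmooth_fsum Finset.univ fun i _ => Energy.isSmooth_mul (hsDQ i) (Energy.isSmooth_coord hA i)).integrable
  have L12 : (∫ y, p1 y) + ∫ y, p2 y =
      -∫ y, ⟪∑ l : Fin 3, (P 0 y) l • sDeriv l (axisAvg (Fin.last 3) (P 0)) y, P 0 y⟫_ℝ := by
    simp only [hp1, hp2]
    rw [integral_inner_sum_smul_sDeriv hP0 hP0 hA]
    ring
  have L3 : ∫ y, p3 y = 0 := by
    simp only [hp3]
    rw [integral_const_mul, integral_inner_sDeriv_axisAvg_eq_zero hP0 hA hAi rfl 2, mul_zero]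
  have L4 : ∫ y, p4 y = 0 := integral_sum_sDeriv_mul_apply_eq_zero (hQ 0) hA hdivA
  have s2 : Integrable (fun y => p1 y + p2 y) := i1.add i2
  have s3 : Integrable (fun y => p1 y + p2 y - p3 y) := s2.sub i3
  -- (4) assemble and split `P_0 = A + V`
  rw [h1, h2, integral_congr_ae (ae_of_all _ key), integral_add s3 i4, integral_sub s2 i3, integral_add i1 i2, L12,
    L3, L4, integral_production_split hP0 hA hAi rfl hdivA]
  ring

end Body

/-- **stub_hierarchyWProduction** (registered tools sub-stub of stmt-AnomalousDissipation-16293): the production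
identity `∫ |k|²‖∂_θP_0‖² = −∫ ⟪(Ṽ·∇_x)A, Ṽ⟫`, `A = axisAvg θ P_0`, `Ṽ = P_0 − A`, explicit-argument form of
`production_identity`. [folklore] -/
theorem stub_hierarchyWProduction : ∀ (j : Fin 3 → ℤ) (i₀ : Fin 3) (G : UnitAddTorus (Fin 3) → ℝ) (f : UnitAddTorus (Fin 3) → EuclideanSpace ℝ (Fin 3)) (N : ℕ) (P : ℕ → UnitAddTorus (Fin 4) → EuclideanSpace ℝ (Fin 3)) (Q : ℕ → UnitAddTorus (Fin 4) → ℝ) (c : ℕ → ℝ), j i₀ ≠ 0 → (∀ x, Literature.Analysis.FunctionSpaces.Torus.partialDeriv i₀ G x = 0) → Literature.Analysis.FunctionSpaces.Torus.IsSmooth G → Literature.Analysis.FunctionSpaces.Torus.IsSmooth f → (∀ a, Literature.Analysis.FunctionSpaces.Torus.IsSmooth (P a)) → (∀ a, Literature.Analysis.FunctionSpaces.Torus.IsSmooth (Q a)) → 1 ≤ N → (∀ y, divCoeff j G N P 0 y = 0) → (∀ y, divCoeff j G N P 1 y = 0) → (∀ y, hierarchyCoeff j G f N P Q c 0 y = 0)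 → (∀ y, hierarchyCoeff j G f N P Q c 1 y = 0) → ∫ y, dissDensity j G (P 0) y = - ∫ y : UnitAddTorus (Fin 4), inner ℝ (∑ l : Fin 3, ((P 0 y - Literature.Analysis.FunctionSpaces.Torus.axisAvg (Fin.last 3) (P 0) y) l) • sDeriv l (Literature.Analysis.FunctionSpaces.Torus.axisAvg (Fin.last 3) (P 0)) y) (P 0 y - Literature.Analysis.FunctionSpaces.Torus.axisAvg (Fin.last 3) (P 0) y) :=
  fun _ _ _ _ _ _ _ _ hj hG0 hG hf hP hQ hN hd0 hd1 hM0 hM1 => production_identity hj hG0 hG hf hP hQ hN hd0 hd1 hM0 hM1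

/-- **stub_hierarchyWShearNecessary** (registered tools sub-stub of stmt-AnomalousDissipation-16293): a formal
solution whose mean flow `axisAvg θ P_0` has no slow gradient is quiet, `∫ |k|²‖∂_θP_0‖² = 0` — mean SHEAR is
necessary for a loud leading wave (corollary of `stub_hierarchyWProduction`). [folklore] -/
theorem stub_hierarchyWShearNecessary : ∀ (j : Fin 3 → ℤ) (i₀ : Fin 3) (G : UnitAddTorus (Fin 3) → ℝ) (f : UnitAddTorus (Fin 3) → EuclideanSpace ℝ (Fin 3)) (N : ℕ) (P : ℕ → UnitAddTorus (Fin 4) → EuclideanSpace ℝ (Fin 3)) (Q : ℕ → UnitAddTorus (Fin 4) → ℝ) (c : ℕ → ℝ), j i₀ ≠ 0 → (∀ x, Literature.Analysis.FunctionSpaces.Torus.partialDeriv i₀ G x = 0) → Literature.Analysis.FunctionSpaces.Torus.IsSmooth G → Literature.Analysis.FunctionSpaces.Torus.IsSmooth f → (∀ a, Literature.Analysis.FunctionSpaces.Torus.IsSmooth (P a)) → (∀ a, Literature.Analysis.FunctionSpaces.Torus.IsSmooth (Q a)) → 1 ≤ N → (∀ y, divCoeff j G N P 0 y = 0) → (∀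 y, divCoeff j G N P 1 y = 0) → (∀ y, hierarchyCoeff j G f N P Q c 0 y = 0) → (∀ y, hierarchyCoeff j G f N P Q c 1 y = 0) → (∀ (l : Fin 3) y, sDeriv l (Literature.Analysis.FunctionSpaces.Torus.axisAvg (Fin.last 3) (P 0)) y = 0) → ∫ y, dissDensity j G (P 0) y = 0 := by
  intro j i₀ G f N P Q c hj hG0 hG hf hP hQ hN hd0 hd1 hM0 hM1 hshear
  rw [stub_hierarchyWProduction j i₀ G f N P Q c hj hG0 hG hf hP hQ hN hd0 hd1 hM0 hM1]
  simp only [hshear, smul_zero, Finset.sum_const_zero, inner_zero_left, integral_zero, neg_zero]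

end Summit.AnomalousDissipation.AnomalousDissipation.Theorems.TaylorWaveQuasiSteady.Production

end
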